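import Literature.MathematicalPhysics.QuantumFieldTheory.Balaban1983to89.HiggsCovariancePos

/-!
# `Balaban1983to89.HiggsHodgeIdentity` — T. Bałaban, *(Higgs)₂,₃ quantum fields in a finite volume. I. A lower bound*,
Commun. Math. Phys. **85** (1982) 603–626 [Balaban1982Higgs1], pp. 604–605, (1.4)–(1.6), (1.8), (1.11): the divergence `∂^{ε*}`
(adjoint of the difference derivative (1.4) for the scalar products (1.5)) and **the lattice Hodge identity
`⟨A,(−Δ^ε)A⟩ = Σ_P ε^d|(∂^εA)(P)|² + Σ_x ε^d|(∂^{ε*}A)(x)|²`**, whence the Feynman-gauge action (1.11) EQUALS the action (1.8) plus the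
gauge-fixing term `½⟨∂^{ε*}A,∂^{ε*}A⟩` plus `E` — PROVED on the CONCRETE carrier `…Balaban1983to89.HiggsLattice`

statement-level skeleton of published theorems with citation tags; proofs where landed; nothing here is a claim about the Yang–Mills mass gap

PDF held: `paper:balaban1982-cmp85-higgs23-i` (journal page = PDF page + 602); p. 605 [PDF 3] re-read on the OCR layer
(`lit read paper:balaban1982-cmp85-higgs23-i --pages 2-4`) against the typer's transcription in `…HiggsLattice`.

WHAT IS REPRODUCED (SKELETON rows **B1.Eq1.8**, **B1.Eq1.9-1.10**, **B1.Eq1.11**, owners r01/r14; first of the five lit-balaban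
seat-p28 (gen 8) files on the passage (1.9) → (1.10), completed in `…Balaban1983to89.B1Eq110GaugeFixing`).  p. 605, verbatim:
*"We introduce here the Feynman gauge and we will consider the integral Z^ε = ∫dA∫dφ exp(−S^ε(A,φ)) (1.10) instead of (1.9), where
the action S^ε is now defined by the formula S^ε(A,φ) = ½⟨φ,(−Δ^ε_A)φ⟩ + Σ_x ε^d(½m₀²|φ(x)|² + λ|φ(x)|⁴) + ½⟨A,(−Δ^ε + μ₀²)A⟩ + E.
(1.11) Here −Δ^ε_A = D^{ε*}_A D^ε_A is the covariant Laplace operator and −Δ^ε = ∂^{ε*}∂^ε is the Laplace operator on the torus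
T_ε."*  On the carriers of `…HiggsLattice` (tori `Site P k`, bonds `PBond P k`, plaquettes `Plaq P k`, `VecField`, `sderiv` (1.4),
`curl` (1.6), `vecLaplaceForm`, `actionPrime` (1.8), `action` (1.11)):
* §1 the gradient `∂^ηλ` of a gauge function (`grad`), the divergence `∂^{η*}` (`div`), `Σ_x(∂^{η*}A)(x) = 0` (`sum_div`),
  **`∂^{η*}` is the adjoint of `∂^η`** for the scalar products (1.5) (`sum_grad_mul`; p. 604: *"The adjoint operators with respect
  to the scalar product … can be easily written up"*), the weighted norm squares `‖A‖²_η`, `‖f‖²_η` (`bondSq`, `siteSq`) and the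
  Hodge orthogonality `∂^{η*}A = 0 ⇒ ‖A − ∂^ηλ‖²_η = ‖A‖²_η + ‖∂^ηλ‖²_η` (`bondSq_sub_grad_of_div_eq_zero`);
* §2 **`vecLaplaceForm A = Σ_P η^d|curl A P|² + ‖∂^{η*}A‖²_η`** (`vecLaplaceForm_eq_curl_add_div`: `−Δ = ∂*∂ + ∂∂*` on lattice
  one-forms — [Balaban1984PropagatorsI] (1.21) `⟨∂A,∂A⟩ = Σ_μ⟨A_μ,ΔA_μ⟩ − ⟨∂*A,∂*A⟩`, in the tree on the OTHER (`Setup`) carrier as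
  `B5Action121.action_identity_121`; here on the (Higgs)₂,₃ torus, by four translations of the torus), whence
  **`action = actionPrime + ½‖∂^{η*}A‖²_η + E`** (`divTerm`, `action_eq_actionPrime_add_divTerm`, refining the typer's
  `HiggsLattice.action_sub_actionPrime`).
Nothing of [Balaban1982Higgs1] beyond the quoted sentences is asserted; no `Prop`-valued fact is introduced.  Unit `lit-balaban-p28`
(Phase-2 proof seat p28, gen 8; DEPGRAPH node `EXT:BFS1979` at its B1 use — the gauge fixing of (1.9)), HOME
`run/shared/lean/pub/lit-balaban/`.
-/

open scoped BigOperators InnerProductSpace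

namespace Literature.MathematicalPhysics.QuantumFieldTheory.Balaban1983to89.HiggsHodgeIdentity

open HiggsLattice HiggsCovariancePos

variable {P : Params} {k N : ℕ}

noncomputable section

/-! ## §1 Gradient, divergence, translations -/

/-- The gradient (1.4) of a real gauge function as a bond field: `(∂^ηλ)(b) = η⁻¹(λ(b₊) − λ(b₋))` (= `HiggsLattice.sderiv λ b`).
[cite: Balaban1982Higgs1, (1.4) p.604] -/
def grad (lam : Site P k → ℝ) : VecField P k := fun b => (P.mesh k)⁻¹ * (lam b.tgt - lam b.src)

/-- The divergence `∂^{η*}` of a bond field, `(∂^{η*}A)(x) = η⁻¹ Σ_μ (A_{⟨x−ηe_μ,x⟩} − A_{⟨x,x+ηe_μ⟩})` — the adjoint of `∂^η` for the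
scalar products (1.5) (p. 604: *"The adjoint operators … can be easily written up"*; sign as in the tree's
`LatticeFieldCalculus.diverg`). [cite: Balaban1982Higgs1, (1.5) p.604] -/
def div (A : VecField P k) : Site P k → ℝ := fun x => ∑ μ : Fin P.d, (P.mesh k)⁻¹ * (A ⟨x.unshift μ, μ⟩ - A ⟨x, μ⟩)

/-- `grad = sderiv` of the typer's carrier. [cite: Balaban1982Higgs1, (1.4) p.604] -/
theorem grad_eq_sderiv (lam : Site P k → ℝ) (b : PBond P k) : grad lam b = sderiv lam b := by
  simp [grad, sderiv, smul_eq_mul]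

/-- `∂^η` is additive. [cite: Balaban1982Higgs1, (1.4) p.604] -/
theorem grad_add (lam lam' : Site P k → ℝ) : grad (lam + lam') = grad lam + grad lam' := by
  funext b; simp only [grad, Pi.add_apply]; ring

/-- `∂^η` commutes with scalars. [cite: Balaban1982Higgs1, (1.4) p.604] -/
theorem grad_smul (t : ℝ) (lam : Site P k → ℝ) : grad (t • lam) = t • grad lam := by
  funext b; simp only [grad, Pi.smul_apply, smul_eq_mul]; ring

/-- `∂^η(−λ) = −∂^ηλ`. [cite: Balaban1982Higgs1, (1.4) p.604] -/
theorem grad_neg (lam : Site P k → ℝ) : grad (-lam) = -grad lam := by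
  funext b; simp only [grad, Pi.neg_apply]; ring

/-- `∂^η λ − ∂^η λ' = ∂^η(λ − λ')`. [cite: Balaban1982Higgs1, (1.4) p.604] -/
theorem grad_sub (lam lam' : Site P k → ℝ) : grad (lam - lam') = grad lam - grad lam' := by
  funext b; simp only [grad, Pi.sub_apply]; ring

/-- A constant gauge function has zero gradient. [cite: Balaban1982Higgs1, (1.4) p.604] -/
theorem grad_const (t : ℝ) : grad (fun _ : Site P k => t) = 0 := by
  funext b; simp [grad]

/-- `∂^{η*}` is additive. [cite: Balaban1982Higgs1, (1.5) p.604] -/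
theorem div_add (A B : VecField P k) : div (A + B) = div A + div B := by
  funext x; simp only [div, Pi.add_apply, ← Finset.sum_add_distrib]; exact Finset.sum_congr rfl fun μ _ => by ring

/-- `∂^{η*}` commutes with subtraction. [cite: Balaban1982Higgs1, (1.5) p.604] -/
theorem div_sub (A B : VecField P k) : div (A - B) = div A - div B := by
  funext x; simp only [div, Pi.sub_apply, ← Finset.sum_sub_distrib]; exact Finset.sum_congr rfl fun μ _ => by ring

/-- `∂^{η*}` commutes with scalars. [cite: Balaban1982Higgs1, (1.5) p.604] -/
theorem div_smul (t : ℝ) (A : VecField P k) : div (t • A) = t • div A := by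
  funext x; simp only [div, Pi.smul_apply, smul_eq_mul, Finset.mul_sum]; exact Finset.sum_congr rfl fun μ _ => by ring

/-- `∂^{η*}(−A) = −∂^{η*}A`. [cite: Balaban1982Higgs1, (1.5) p.604] -/
theorem div_neg (A : VecField P k) : div (-A) = -div A := by
  funext x; simp only [div, Pi.neg_apply, ← Finset.sum_neg_distrib]; exact Finset.sum_congr rfl fun μ _ => by ring

/-- Translation of a site sum by `+ηe_μ`. [folklore] -/
private theorem sum_shift {M : Type*} [AddCommMonoid M] (μ : Fin P.d) (h : Site P k → M) :
    ∑ x : Site P k, h (x.shift μ) = ∑ x : Site P k, h x :=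
  Equiv.sum_comp (shiftEquiv P k μ) h

/-- Translation of a site sum by `−ηe_μ`. [folklore] -/
private theorem sum_unshift {M : Type*} [AddCommMonoid M] (μ : Fin P.d) (h : Site P k → M) :
    ∑ x : Site P k, h (x.unshift μ) = ∑ x : Site P k, h x :=
  Equiv.sum_comp (shiftEquiv P k μ).symm h

/-- The translations `x ↦ x + ηe_μ` of the torus `T_η` (1.2) commute. [cite: Balaban1982Higgs1, (1.2) p.604] -/
theorem shift_comm (x : Site P k) (μ ν : Fin P.d) : (x.shift μ).shift ν = (x.shift ν).shift μ := by
  funext κ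
  by_cases h1 : κ = ν
  · subst h1
    by_cases h2 : κ = μ
    · subst h2; rfl
    · simp [Site.shift, Function.update_self, Function.update_of_ne h2]
  · by_cases h2 : κ = μ
    · subst h2
      simp [Site.shift, Function.update_self, Function.update_of_ne h1]
    · simp [Site.shift, Function.update_of_ne h1, Function.update_of_ne h2]

/-- `Σ_x (∂^{η*}A)(x) = 0` on the torus (divergence theorem without boundary). [cite: Balaban1982Higgs1, (1.5) p.604] -/
theorem sum_div (A : VecField P k) : ∑ x : Site P k, div A x = 0 := by
  unfold div
  rw [Finset.sum_comm]
  refine Finset.sum_eq_zero fun μ _ => ?_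
  rw [← Finset.mul_sum, Finset.sum_sub_distrib, sum_unshift μ (fun x => A ⟨x, μ⟩), sub_self, mul_zero]

/-- **`∂^{η*}` is the adjoint of `∂^η`** for the scalar products (1.5): `Σ_b η^d (∂^ηλ)(b) A(b) = Σ_x η^d λ(x) (∂^{η*}A)(x)`.
[cite: Balaban1982Higgs1, (1.5) p.604] -/
theorem sum_grad_mul (lam : Site P k → ℝ) (A : VecField P k) :
    ∑ b : PBond P k, P.mesh k ^ P.d * (grad lam b * A b) = ∑ x : Site P k, P.mesh k ^ P.d * (lam x * div A x) := by
  have hL : ∑ b : PBond P k, P.mesh k ^ P.d * (grad lam b * A b)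
      = ∑ x : Site P k, ∑ μ : Fin P.d, P.mesh k ^ P.d * ((P.mesh k)⁻¹ * (lam (x.shift μ) - lam x) * A ⟨x, μ⟩) := by
    rw [sum_site_dir]; rfl
  rw [hL]
  simp only [div, Finset.mul_sum]
  rw [Finset.sum_comm]
  conv_rhs => rw [Finset.sum_comm]
  refine Finset.sum_congr rfl fun μ _ => ?_
  have h1 : ∑ x : Site P k, P.mesh k ^ P.d * ((P.mesh k)⁻¹ * lam (x.shift μ) * A ⟨x, μ⟩)
      = ∑ x : Site P k, P.mesh k ^ P.d * ((P.mesh k)⁻¹ * lam x * A ⟨x.unshift μ, μ⟩) := by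
    rw [← sum_unshift μ (fun x => P.mesh k ^ P.d * ((P.mesh k)⁻¹ * lam (x.shift μ) * A ⟨x, μ⟩))]
    simp only [shift_unshift]
  calc ∑ x : Site P k, P.mesh k ^ P.d * ((P.mesh k)⁻¹ * (lam (x.shift μ) - lam x) * A ⟨x, μ⟩)
      = ∑ x : Site P k, P.mesh k ^ P.d * ((P.mesh k)⁻¹ * lam (x.shift μ) * A ⟨x, μ⟩)
          - ∑ x : Site P k, P.mesh k ^ P.d * ((P.mesh k)⁻¹ * lam x * A ⟨x, μ⟩) := by
        rw [← Finset.sum_sub_distrib]; exact Finset.sum_congr rfl fun x _ => by ring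
    _ = ∑ x : Site P k, P.mesh k ^ P.d * ((P.mesh k)⁻¹ * lam x * A ⟨x.unshift μ, μ⟩)
          - ∑ x : Site P k, P.mesh k ^ P.d * ((P.mesh k)⁻¹ * lam x * A ⟨x, μ⟩) := by rw [h1]
    _ = ∑ x : Site P k, P.mesh k ^ P.d * (lam x * ((P.mesh k)⁻¹ * (A ⟨x.unshift μ, μ⟩ - A ⟨x, μ⟩))) := by
        rw [← Finset.sum_sub_distrib]; exact Finset.sum_congr rfl fun x _ => by ring

/-- The `η^d`-weighted `ℓ²` norm square of a bond field, `‖A‖²_η = Σ_b η^d A_b²` ((1.5) on bonds). [cite: Balaban1982Higgs1, (1.5) p.604] -/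
def bondSq (A : VecField P k) : ℝ := ∑ b : PBond P k, P.mesh k ^ P.d * (A b) ^ 2

/-- The `η^d`-weighted `ℓ²` norm square of a real site function. [cite: Balaban1982Higgs1, (1.5) p.604] -/
def siteSq (f : Site P k → ℝ) : ℝ := ∑ x : Site P k, P.mesh k ^ P.d * (f x) ^ 2

/-- `‖A‖²_η ≥ 0`. [cite: Balaban1982Higgs1, (1.5) p.604] -/
theorem bondSq_nonneg (A : VecField P k) : 0 ≤ bondSq A :=
  Finset.sum_nonneg fun _ _ => mul_nonneg (pow_nonneg (P.mesh_pos k).le _) (sq_nonneg _)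

/-- `‖f‖²_η ≥ 0`. [cite: Balaban1982Higgs1, (1.5) p.604] -/
theorem siteSq_nonneg (f : Site P k → ℝ) : 0 ≤ siteSq f :=
  Finset.sum_nonneg fun _ _ => mul_nonneg (pow_nonneg (P.mesh_pos k).le _) (sq_nonneg _)

/-- `‖−A‖²_η = ‖A‖²_η`. [cite: Balaban1982Higgs1, (1.5) p.604] -/
theorem bondSq_neg (A : VecField P k) : bondSq (-A) = bondSq A := by
  simp [bondSq]

/-- `‖−f‖²_η = ‖f‖²_η`. [cite: Balaban1982Higgs1, (1.5) p.604] -/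
theorem siteSq_neg (f : Site P k → ℝ) : siteSq (-f) = siteSq f := by
  simp [siteSq]

/-- Polarisation: `‖A − B‖²_η = ‖A‖²_η − 2⟨A,B⟩_η + ‖B‖²_η`. [cite: Balaban1982Higgs1, (1.5) p.604] -/
theorem bondSq_sub (A B : VecField P k) :
    bondSq (A - B) = bondSq A - 2 * ∑ b : PBond P k, P.mesh k ^ P.d * (A b * B b) + bondSq B := by
  simp only [bondSq, Pi.sub_apply, Finset.mul_sum, ← Finset.sum_sub_distrib, ← Finset.sum_add_distrib]
  exact Finset.sum_congr rfl fun b _ => by ring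

/-- **Orthogonality of the Hodge splitting**: if `∂^{η*}A = 0` then `‖A − ∂^ηλ‖²_η = ‖A‖²_η + ‖∂^ηλ‖²_η` for every gauge
function `λ` (the cross term is `⟨∂^{η*}A, λ⟩ = 0`). [cite: Balaban1982Higgs1, (1.5) p.604] -/
theorem bondSq_sub_grad_of_div_eq_zero {A : VecField P k} (hA : div A = 0) (lam : Site P k → ℝ) :
    bondSq (A - grad lam) = bondSq A + bondSq (grad lam) := by
  rw [bondSq_sub]
  have h : ∑ b : PBond P k, P.mesh k ^ P.d * (A b * grad lam b) = 0 := by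
    have h' := sum_grad_mul lam A
    simp only [hA, Pi.zero_apply, mul_zero, Finset.sum_const_zero] at h'
    simpa only [mul_comm (A _) (grad lam _)] using h'
  rw [h]; ring

/-! ## §2 The lattice Hodge identity and `S^ε = S'^ε + ½‖∂^{ε*}A‖² + E` -/

section Hodge

/-- forward difference of a real site function in direction `μ` (no `η⁻¹`). [folklore] -/
private def fd (μ : Fin P.d) (f : Site P k → ℝ) (x : Site P k) : ℝ := f (x.shift μ) - f x

/-- The resummation behind the Hodge identity: `Σ_x (∂_μf)(x)(∂_νg)(x) = Σ_x (∂_νf)(x+ηe_μ)(∂_μg)(x+ηe_ν)` on the torus (four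
translations). [folklore] -/
private theorem sum_fd_mul_fd (μ ν : Fin P.d) (f g : Site P k → ℝ) :
    ∑ x : Site P k, fd μ f x * fd ν g x = ∑ x : Site P k, fd ν f (x.shift μ) * fd μ g (x.shift ν) := by
  simp only [fd]
  have e1 : ∑ x : Site P k, f ((x.shift μ).shift ν) * g ((x.shift ν).shift μ) = ∑ x : Site P k, f x * g x := by
    have := sum_shift ν (fun y : Site P k => f y * g y)
    rw [← this, ← sum_shift μ (fun y : Site P k => f (y.shift ν) * g (y.shift ν))]
    exact Finset.sum_congr rfl fun x _ => by rw [shift_comm x ν μ]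
  have e2 : ∑ x : Site P k, f ((x.shift μ).shift ν) * g (x.shift ν) = ∑ x : Site P k, f (x.shift μ) * g x := by
    rw [← sum_shift ν (fun y : Site P k => f (y.shift μ) * g y)]
    exact Finset.sum_congr rfl fun x _ => by rw [shift_comm]
  have e3 : ∑ x : Site P k, f (x.shift μ) * g ((x.shift ν).shift μ) = ∑ x : Site P k, f x * g (x.shift ν) := by
    rw [← sum_shift μ (fun y : Site P k => f y * g (y.shift ν))]
    exact Finset.sum_congr rfl fun x _ => by rw [shift_comm]
  have eL : ∑ x : Site P k, (f (x.shift μ) - f x) * (g (x.shift ν) - g x)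
      = ∑ x : Site P k, f (x.shift μ) * g (x.shift ν) - ∑ x : Site P k, f (x.shift μ) * g x
        - ∑ x : Site P k, f x * g (x.shift ν) + ∑ x : Site P k, f x * g x := by
    rw [← Finset.sum_sub_distrib, ← Finset.sum_sub_distrib, ← Finset.sum_add_distrib]
    exact Finset.sum_congr rfl fun x _ => by ring
  have eR : ∑ x : Site P k, (f ((x.shift μ).shift ν) - f (x.shift μ)) * (g ((x.shift ν).shift μ) - g (x.shift ν))
      = ∑ x : Site P k, f ((x.shift μ).shift ν) * g ((x.shift ν).shift μ)
        - ∑ x : Site P k, f ((x.shift μ).shift ν) * g (x.shift ν)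
        - ∑ x : Site P k, f (x.shift μ) * g ((x.shift ν).shift μ) + ∑ x : Site P k, f (x.shift μ) * g (x.shift ν) := by
    rw [← Finset.sum_sub_distrib, ← Finset.sum_sub_distrib, ← Finset.sum_add_distrib]
    exact Finset.sum_congr rfl fun x _ => by ring
  rw [eL, eR, e1, e2, e3]
  ring

/-- `vecLaplaceForm` without its prefactor: `Σ_μ Σ_x Σ_ν (∂_νA_μ)(x)²`. [cite: Balaban1982Higgs1, (1.11) p.605] -/
private theorem vecLaplaceForm_eq_fd (A : VecField P k) :
    vecLaplaceForm A = P.mesh k ^ P.d * (P.mesh k)⁻¹ ^ 2 *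
      ∑ μ : Fin P.d, ∑ x : Site P k, ∑ ν : Fin P.d, (fd ν (A.comp μ) x) ^ 2 := by
  unfold vecLaplaceForm
  rw [Finset.mul_sum]
  refine Finset.sum_congr rfl fun μ _ => ?_
  rw [← sum_site_dir (f := fun (x : Site P k) (ν : Fin P.d) => P.mesh k ^ P.d * (sderiv (A.comp μ) ⟨x, ν⟩) ^ 2),
    Finset.mul_sum]
  refine Finset.sum_congr rfl fun x _ => ?_
  rw [Finset.mul_sum]
  refine Finset.sum_congr rfl fun ν _ => ?_
  simp only [sderiv, smul_eq_mul, fd, PBond.tgt]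
  ring

/-- the curl term without its prefactor: `½ Σ_x Σ_μ Σ_ν (∂_μA_ν − ∂_νA_μ)(x)²` (the summand is symmetric in `μ,ν` and vanishes on
the diagonal, so the sum over plaquettes `μ < ν` is half the full double sum). [cite: Balaban1982Higgs1, (1.6) p.604] -/
private theorem curlTerm_eq_fd (A : VecField P k) :
    ∑ p : Plaq P k, P.mesh k ^ P.d * (curl A p) ^ 2 = P.mesh k ^ P.d * (P.mesh k)⁻¹ ^ 2 *
      ((1 / 2) * ∑ x : Site P k, ∑ μ : Fin P.d, ∑ ν : Fin P.d, (fd μ (A.comp ν) x - fd ν (A.comp μ) x) ^ 2) := by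
  -- the symmetric summand
  set F : Site P k → Fin P.d → Fin P.d → ℝ := fun x μ ν => (fd μ (A.comp ν) x - fd ν (A.comp μ) x) ^ 2 with hF
  have hsymm : ∀ x μ ν, F x μ ν = F x ν μ := fun x μ ν => by simp only [hF]; ring
  have hdiag : ∀ x μ, F x μ μ = 0 := fun x μ => by simp [hF]
  -- plaquettes ↔ ordered pairs `μ < ν`
  let e : {t : Site P k × Fin P.d × Fin P.d // t.2.1 < t.2.2} ≃ Plaq P k :=
    ⟨fun t => ⟨t.1.1, t.1.2.1, t.1.2.2, t.2⟩, fun p => ⟨(p.src, p.μ, p.ν), p.hμν⟩, fun _ => rfl, fun _ => rfl⟩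
  have hcurl : ∀ p : Plaq P k, P.mesh k ^ P.d * (curl A p) ^ 2
      = P.mesh k ^ P.d * (P.mesh k)⁻¹ ^ 2 * F p.src p.μ p.ν := by
    intro p
    simp only [hF, curl, fd, VecField.comp]
    ring
  set G : Site P k × Fin P.d × Fin P.d → ℝ := fun t => P.mesh k ^ P.d * (P.mesh k)⁻¹ ^ 2 * F t.1 t.2.1 t.2.2 with hG
  have h1 : ∑ p : Plaq P k, P.mesh k ^ P.d * (curl A p) ^ 2
      = ∑ t : {t : Site P k × Fin P.d × Fin P.d // t.2.1 < t.2.2}, G t := by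
    rw [← Equiv.sum_comp e]
    exact Finset.sum_congr rfl fun t _ => hcurl (e t)
  have h2 : ∑ t : {t : Site P k × Fin P.d × Fin P.d // t.2.1 < t.2.2}, G t
      = ∑ t : Site P k × Fin P.d × Fin P.d, if t.2.1 < t.2.2 then G t else 0 := by
    rw [← Finset.sum_filter,
      Finset.sum_subtype (Finset.univ.filter fun t : Site P k × Fin P.d × Fin P.d => t.2.1 < t.2.2)
        (p := fun t : Site P k × Fin P.d × Fin P.d => t.2.1 < t.2.2) (fun t => by simp)]
  have h3 : ∑ t : Site P k × Fin P.d × Fin P.d, (if t.2.1 < t.2.2 then G t else 0)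
      = ∑ x : Site P k, ∑ μ : Fin P.d, ∑ ν : Fin P.d,
          if μ < ν then P.mesh k ^ P.d * (P.mesh k)⁻¹ ^ 2 * F x μ ν else 0 := by
    rw [Fintype.sum_prod_type]
    refine Finset.sum_congr rfl fun x _ => ?_
    rw [Fintype.sum_prod_type]
  -- the half-sum identity, per site
  have h4 : ∀ x : Site P k, ∑ μ : Fin P.d, ∑ ν : Fin P.d, (if μ < ν then F x μ ν else 0)
      = (1 / 2) * ∑ μ : Fin P.d, ∑ ν : Fin P.d, F x μ ν := by
    intro x
    have hsplit : ∀ μ ν : Fin P.d, F x μ ν = (if μ < ν then F x μ ν else 0) + (if ν < μ then F x μ ν else 0) := by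
      intro μ ν
      rcases lt_trichotomy μ ν with h | h | h
      · simp [h, not_lt.2 h.le]
      · subst h; simp [hdiag]
      · simp [h, not_lt.2 h.le]
    have hswap : ∑ μ : Fin P.d, ∑ ν : Fin P.d, (if ν < μ then F x μ ν else 0)
        = ∑ μ : Fin P.d, ∑ ν : Fin P.d, (if μ < ν then F x μ ν else 0) := by
      rw [Finset.sum_comm]
      refine Finset.sum_congr rfl fun μ _ => Finset.sum_congr rfl fun ν _ => ?_
      split_ifs <;> simp [hsymm]
    have : ∑ μ : Fin P.d, ∑ ν : Fin P.d, F x μ ν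
        = ∑ μ : Fin P.d, ∑ ν : Fin P.d, (if μ < ν then F x μ ν else 0)
          + ∑ μ : Fin P.d, ∑ ν : Fin P.d, (if ν < μ then F x μ ν else 0) := by
      rw [← Finset.sum_add_distrib]
      refine Finset.sum_congr rfl fun μ _ => ?_
      rw [← Finset.sum_add_distrib]
      exact Finset.sum_congr rfl fun ν _ => hsplit μ ν
    rw [this, hswap]
    ring
  rw [h1, h2, h3]
  have h5 : ∀ x : Site P k, ∑ μ : Fin P.d, ∑ ν : Fin P.d, (if μ < ν then P.mesh k ^ P.d * (P.mesh k)⁻¹ ^ 2 * F x μ ν else 0)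
      = P.mesh k ^ P.d * (P.mesh k)⁻¹ ^ 2 * ∑ μ : Fin P.d, ∑ ν : Fin P.d, (if μ < ν then F x μ ν else 0) := by
    intro x
    rw [Finset.mul_sum]
    refine Finset.sum_congr rfl fun μ _ => ?_
    rw [Finset.mul_sum]
    refine Finset.sum_congr rfl fun ν _ => ?_
    split_ifs <;> simp
  simp_rw [h5, h4]
  rw [← Finset.mul_sum, ← Finset.mul_sum]

/-- the divergence term without its prefactor: `Σ_x (Σ_μ (A_μ(x−ηe_μ) − A_μ(x)))²`, written with the forward differences at
the shifted sites. [cite: Balaban1982Higgs1, (1.5) p.604] -/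
private theorem divTerm_eq_fd (A : VecField P k) :
    siteSq (div A) = P.mesh k ^ P.d * (P.mesh k)⁻¹ ^ 2 *
      ∑ x : Site P k, ∑ μ : Fin P.d, ∑ ν : Fin P.d, fd μ (A.comp μ) (x.unshift μ) * fd ν (A.comp ν) (x.unshift ν) := by
  unfold siteSq
  rw [Finset.mul_sum]
  refine Finset.sum_congr rfl fun x _ => ?_
  have hx : div A x = -((P.mesh k)⁻¹ * ∑ μ : Fin P.d, fd μ (A.comp μ) (x.unshift μ)) := by
    simp only [div, fd, VecField.comp, shift_unshift, Finset.mul_sum, ← Finset.sum_neg_distrib]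
    exact Finset.sum_congr rfl fun μ _ => by ring
  have hS : (∑ μ : Fin P.d, fd μ (A.comp μ) (x.unshift μ)) ^ 2
      = ∑ μ : Fin P.d, ∑ ν : Fin P.d, fd μ (A.comp μ) (x.unshift μ) * fd ν (A.comp ν) (x.unshift ν) := by
    rw [sq, Finset.sum_mul_sum]
  rw [hx, neg_sq, mul_pow, hS]
  ring

/-- **THE LATTICE HODGE IDENTITY on the (Higgs)₂,₃ torus**: `⟨A,(−Δ^η)A⟩ = Σ_P η^d |(∂^ηA)(P)|² + Σ_x η^d |(∂^{η*}A)(x)|²`, i.e.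
`−Δ = ∂*∂ + ∂∂*` on lattice one-forms — p. 605 *"−Δ^ε = ∂^{ε*}∂^ε is the Laplace operator on the torus"* acting componentwise
(`vecLaplaceForm`) versus the curl (1.6) and the divergence; [Balaban1984PropagatorsI] (1.21) on this carrier.
[cite: Balaban1982Higgs1, (1.11) p.605] -/
theorem vecLaplaceForm_eq_curl_add_div (A : VecField P k) :
    vecLaplaceForm A = ∑ p : Plaq P k, P.mesh k ^ P.d * (curl A p) ^ 2 + siteSq (div A) := by
  rw [vecLaplaceForm_eq_fd, curlTerm_eq_fd, divTerm_eq_fd, ← mul_add]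
  congr 1
  -- reduce to: Σ_μΣ_xΣ_ν (fd ν a_μ x)² = ½ΣΣΣ (fd μ a_ν − fd ν a_μ)² + ΣΣΣ fd μ a_μ (x−μ) fd ν a_ν (x−ν)
  have hcross : ∀ μ ν : Fin P.d, ∑ x : Site P k, fd μ (A.comp μ) (x.unshift μ) * fd ν (A.comp ν) (x.unshift ν)
      = ∑ x : Site P k, fd μ (A.comp ν) x * fd ν (A.comp μ) x := by
    intro μ ν
    rw [sum_fd_mul_fd μ ν (A.comp ν) (A.comp μ)]
    rw [← sum_shift μ (fun x => fd μ (A.comp μ) (x.unshift μ) * fd ν (A.comp ν) (x.unshift ν)),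
      ← sum_shift ν (fun x => fd μ (A.comp μ) ((x.shift μ).unshift μ) * fd ν (A.comp ν) ((x.shift μ).unshift ν))]
    refine Finset.sum_congr rfl fun x _ => ?_
    rw [unshift_shift, shift_comm x ν μ, unshift_shift, mul_comm]
  have hsq : ∀ (x : Site P k) (μ ν : Fin P.d), (fd μ (A.comp ν) x - fd ν (A.comp μ) x) ^ 2
      = (fd μ (A.comp ν) x) ^ 2 + (fd ν (A.comp μ) x) ^ 2 - 2 * (fd μ (A.comp ν) x * fd ν (A.comp μ) x) := by
    intro x μ ν; ring
  -- regroup the site sums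
  have hC : (1 / 2 : ℝ) * ∑ x : Site P k, ∑ μ : Fin P.d, ∑ ν : Fin P.d, (fd μ (A.comp ν) x - fd ν (A.comp μ) x) ^ 2
      = ∑ μ : Fin P.d, ∑ x : Site P k, ∑ ν : Fin P.d, (fd ν (A.comp μ) x) ^ 2
        - ∑ μ : Fin P.d, ∑ ν : Fin P.d, ∑ x : Site P k, fd μ (A.comp ν) x * fd ν (A.comp μ) x := by
    have hA1 : ∑ x : Site P k, ∑ μ : Fin P.d, ∑ ν : Fin P.d, (fd μ (A.comp ν) x) ^ 2
        = ∑ μ : Fin P.d, ∑ x : Site P k, ∑ ν : Fin P.d, (fd ν (A.comp μ) x) ^ 2 := by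
      refine (Finset.sum_congr rfl fun x _ => Finset.sum_comm).trans ?_
      rw [Finset.sum_comm]
    have hA2 : ∑ x : Site P k, ∑ μ : Fin P.d, ∑ ν : Fin P.d, (fd ν (A.comp μ) x) ^ 2
        = ∑ μ : Fin P.d, ∑ x : Site P k, ∑ ν : Fin P.d, (fd ν (A.comp μ) x) ^ 2 := by
      rw [Finset.sum_comm]
    have hA3 : ∑ x : Site P k, ∑ μ : Fin P.d, ∑ ν : Fin P.d, fd μ (A.comp ν) x * fd ν (A.comp μ) x
        = ∑ μ : Fin P.d, ∑ ν : Fin P.d, ∑ x : Site P k, fd μ (A.comp ν) x * fd ν (A.comp μ) x := by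
      rw [Finset.sum_comm]
      refine Finset.sum_congr rfl fun μ _ => ?_
      rw [Finset.sum_comm]
    simp_rw [hsq]
    simp only [Finset.sum_sub_distrib, Finset.sum_add_distrib, ← Finset.mul_sum]
    rw [hA1, hA2, hA3]
    ring
  have hV : ∑ x : Site P k, ∑ μ : Fin P.d, ∑ ν : Fin P.d, fd μ (A.comp μ) (x.unshift μ) * fd ν (A.comp ν) (x.unshift ν)
      = ∑ μ : Fin P.d, ∑ ν : Fin P.d, ∑ x : Site P k, fd μ (A.comp ν) x * fd ν (A.comp μ) x := by
    rw [Finset.sum_comm]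
    refine Finset.sum_congr rfl fun μ _ => ?_
    rw [Finset.sum_comm]
    exact Finset.sum_congr rfl fun ν _ => hcross μ ν
  rw [hC, hV]
  ring

/-- Half the `η^d`-weighted norm square of the divergence — THE FEYNMAN GAUGE-FIXING TERM `½⟨∂^{ε*}A, ∂^{ε*}A⟩` by which (1.11)
exceeds (1.8). [cite: Balaban1982Higgs1, (1.11) p.605] -/
def divTerm (A : VecField P k) : ℝ := siteSq (div A) / 2

/-- **(1.11) = (1.8) + gauge fixing**: `S^ε(A,φ) = S'^ε(A,φ) + ½ Σ_x ε^d |(∂^{ε*}A)(x)|² + E` — the Feynman gauge of p. 605, made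
exact on the carrier (refines `HiggsLattice.action_sub_actionPrime` by the Hodge identity). [cite: Balaban1982Higgs1, (1.11) p.605] -/
theorem action_eq_actionPrime_add_divTerm (C : ChargeData N) (c : Couplings) (A : VecField P k) (φ : ScalarField P k N) :
    action C c A φ = actionPrime C c A φ + divTerm A + c.E := by
  have h := action_sub_actionPrime C c A φ
  rw [vecLaplaceForm_eq_curl_add_div] at h
  unfold divTerm
  linarith

end Hodge

end

end Literature.MathematicalPhysics.QuantumFieldTheory.Balaban1983to89.HiggsHodgeIdentity
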